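import Summits.HubbardSuperconductivity.HubbardSuperconductivity.Theorems.AnisotropyChordTransferFibre3RowDNTerm
import Summits.HubbardSuperconductivity.HubbardSuperconductivity.Theorems.AnisotropyChordTransferFibre3RowDResidSplit

/-!
# Route `AnisotropyChord` / H0 rotor rung, row D (KT-2a) Stage-1 evaluator: the `NT` term `(T⁺ − 3λ₂)·Ψ̂¹(k)`, SPLIT, closed part EXACT

Layer G of the row-D program (p1 g29 memo ROWD-DESIGN-g29 §6, p1 g30).  The last term of g27's `RhatCancelled` is
`−(T⁺ − 3λ₂)·Ψ̂¹(k)`, `Ψ̂¹(k₂,k₃) = Π̂(k₂,k₃) + Π̂(k₂−K₁,k₃) + Π̂(k₂,k₃−K₁)`, `Π̂ = cfgDFT(prodState f)`.  Writing the product state as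
`prod3 f f f` and `f = f_JU + f_S` (★ `prod3_expand`: the sum over ALL eight slot monomials `monoList8`), each monomial transform is
`closedPartU + loopPartU` of three plain typed specs (`piHat_slots`); hence
★ `piHat_split : Π̂(q₂,q₃) = piClosedU + piLoopU`, ★ `psiHat1_split : Ψ̂¹(k₂,k₃) = ntClosedU + ntLoopU`,
and the closed half is a REAL `RExpr`: ★ `piClosedE q₂ q₃ := Σ_8 closedM`, ★ `ntClosedE k₂ k₃` (three translates) with
★ `ntClosedE_eval : V²·(ntClosedE k₂ k₃).eval xTrueD = ntClosedU(k̄₂,k̄₃)` under the decidable `ntOk k₂ k₃`.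
(The loop half `ntLoopU` — plain three-slot loops, `bndM` of `…RowDLoopTables` — and the prefactor `(T⁺ − 3λ₂)/θ² = τ − 3ν` are handled
by the majorant layer.)
Prover seat `hubbard-h0-rotor-p1` g30 (route lead); helper for piece A = stmt-HubbardSuperconductivity-23918 of rung 19089
(`--supports`, helper class).  Nothing here proves superconductivity in the Hubbard model; lemmas for ONE row of ONE conditional reduction;
the rotor TARGET as originally worded stays FALSE (g15 verdict).  Tree imports only; no sorry.
-/

set_option linter.dupNamespace false
set_option autoImplicit false

open Literature.Analysis.ValidatedNumerics

namespace Summit.HubbardSuperconductivity.HubbardSuperconductivity.Theorems.AnisotropyChord.Transfer.Fibre3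

namespace RowD

open RowC L2.N1

variable (L : ℕ) [NeZero L]

/-! ## The eight monomials of the product state -/

/-- all eight slot monomials `(k1, k2, k3) ∈ {JU,S}³` (`monoList` plus `(JU,JU,JU)`). -/
def monoList8 : List (Bool × Bool × Bool) := (false, false, false) :: monoList

omit [NeZero L] in
/-- additivity of `prod3` in each slot. [folklore] -/
theorem prod3_add (F F' G G' H H' : Tor L → ℝ) (c : Cfg L) :
    prod3 L (fun r => F r + F' r) G H c = prod3 L F G H c + prod3 L F' G H c ∧
    prod3 L F (fun r => G r + G' r) H c = prod3 L F G H c + prod3 L F G' H c ∧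
    prod3 L F G (fun r => H r + H' r) c = prod3 L F G H c + prod3 L F G H' c := by
  unfold prod3; exact ⟨by ring, by ring, by ring⟩

omit [NeZero L] in
/-- ★ the product state over the eight slot monomials: `prod3 f f f = Σ_{monoList8} prod3 (slot k1) (slot k2) (slot k3)`. [folklore] -/
theorem prod3_expand (Δ : ℝ) (f : Tor L → ℝ) (c : Cfg L) :
    prod3 L f f f c = (monoList8.map (fun m => prod3 L (slot L Δ f m.1) (slot L Δ f m.2.1) (slot L Δ f m.2.2) c)).sum := by
  have hf := f_eq_fJU_add_fS L Δ f
  conv_lhs => rw [hf]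
  simp only [monoList8, monoList, slot, List.map_cons, List.map_nil, List.sum_cons, List.sum_nil, add_zero,
    Bool.false_eq_true, if_true, if_false]
  unfold prod3
  ring

omit [NeZero L] in
/-- `prodState f = prod3 f f f` (as a complex function). [folklore] -/
theorem prodState_eq_prod3 (f : Tor L → ℝ) : prodState L f = fun c => ((prod3 L f f f c : ℝ) : ℂ) := by
  funext c; unfold prodState prod3; rfl

/-! ## The split of `Π̂` and `Ψ̂¹` -/

section semantic
variable (Δ lam2 : ℝ) (f : Tor L → ℝ)

/-- the closed half of `Π̂(q₂,q₃)`: `Σ_8 closedPartU` of the plain typed specs. -/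
noncomputable def piClosedU (e0 : Tor L) (q₂ q₃ : Tor L) : ℂ :=
  (monoList8.map (fun m => closedPartU L lam2 (psiU L Δ lam2 f m.2.2 1 0 e0) (psiU L Δ lam2 f m.1 1 0 e0)
    (psiU L Δ lam2 f m.2.1 1 0 e0) q₂ q₃)).sum

/-- the loop half of `Π̂(q₂,q₃)`: `Σ_8 loopPartU` (plain three-slot loops; majorised by `bndM`). -/
noncomputable def piLoopU (e0 : Tor L) (q₂ q₃ : Tor L) : ℂ :=
  (monoList8.map (fun m => loopPartU L lam2 (psiU L Δ lam2 f m.2.2 1 0 e0) (psiU L Δ lam2 f m.1 1 0 e0)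
    (psiU L Δ lam2 f m.2.1 1 0 e0) q₂ q₃)).sum

/-- ★ `Π̂(q₂,q₃) = piClosedU + piLoopU` (ground profile, `L ≥ 5`, `0 ≤ Δ < 1`). -/
theorem piHat_split (hL : 5 ≤ L) (hΔ0 : 0 ≤ Δ) (hΔ1 : Δ < 1) (hf : IsGroundTwoMagnon L Δ lam2 f) (e0 q₂ q₃ : Tor L) :
    PiHat L f q₂ q₃ = piClosedU L Δ lam2 f e0 q₂ q₃ + piLoopU L Δ lam2 f e0 q₂ q₃ := by
  unfold PiHat
  rw [prodState_eq_prod3]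
  have hexp : (fun c => ((prod3 L f f f c : ℝ) : ℂ))
      = fun c => (monoList8.map (fun m => (fun c' => ((prod3 L (slot L Δ f m.1) (slot L Δ f m.2.1) (slot L Δ f m.2.2) c' : ℝ) : ℂ)) c)).sum := by
    funext c
    rw [prod3_expand L Δ f c]
    simp only [monoList8, monoList, List.map_cons, List.map_nil, List.sum_cons, List.sum_nil]
    push_cast; ring
  rw [hexp, cfgDFT_listsum]
  unfold piClosedU piLoopU
  simp only [monoList8, monoList, List.map_cons, List.map_nil, List.sum_cons, List.sum_nil,
    piHat_slots L Δ lam2 f hL hΔ0 hΔ1 hf _ _ _ e0]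
  ring

/-- the closed half of `Ψ̂¹(k₂,k₃)` (three translates). -/
noncomputable def ntClosedU (e0 : Tor L) (k₂ k₃ : Tor L) : ℂ :=
  piClosedU L Δ lam2 f e0 k₂ k₃ + piClosedU L Δ lam2 f e0 (k₂ - K1 L) k₃ + piClosedU L Δ lam2 f e0 k₂ (k₃ - K1 L)

/-- the loop half of `Ψ̂¹(k₂,k₃)`. -/
noncomputable def ntLoopU (e0 : Tor L) (k₂ k₃ : Tor L) : ℂ :=
  piLoopU L Δ lam2 f e0 k₂ k₃ + piLoopU L Δ lam2 f e0 (k₂ - K1 L) k₃ + piLoopU L Δ lam2 f e0 k₂ (k₃ - K1 L)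

/-- ★ `Ψ̂¹(k₂,k₃) = ntClosedU + ntLoopU`. -/
theorem psiHat1_split (hL : 5 ≤ L) (hΔ0 : 0 ≤ Δ) (hΔ1 : Δ < 1) (hf : IsGroundTwoMagnon L Δ lam2 f) (e0 k₂ k₃ : Tor L) :
    PsiHat1 L f k₂ k₃ = ntClosedU L Δ lam2 f e0 k₂ k₃ + ntLoopU L Δ lam2 f e0 k₂ k₃ := by
  unfold PsiHat1 ntClosedU ntLoopU
  rw [piHat_split L Δ lam2 f hL hΔ0 hΔ1 hf e0, piHat_split L Δ lam2 f hL hΔ0 hΔ1 hf e0, piHat_split L Δ lam2 f hL hΔ0 hΔ1 hf e0]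
  ring

end semantic

/-! ## The closed half as a real `RExpr` -/

/-- ★ `piClosedU(q̄₂,q̄₃)/V²` as a real `RExpr`: `Σ_8 closedM` (argument order `closedM k3 k1 k2`, monomial `(k1,k2,k3)`). -/
def piClosedE (q₂ q₃ : ℤ × ℤ) : RExpr :=
  .add (.add (.add (.add (.add (.add (.add
    (closedM false false false q₂ q₃) (closedM true false false q₂ q₃)) (closedM false false true q₂ q₃))
    (closedM true false true q₂ q₃)) (closedM false true false q₂ q₃)) (closedM true true false q₂ q₃))
    (closedM false true true q₂ q₃)) (closedM true true true q₂ q₃)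

/-- ★ `ntClosedU(k̄₂,k̄₃)/V²`: the three translates. -/
def ntClosedE (k₂ k₃ : ℤ × ℤ) : RExpr :=
  .add (.add (piClosedE k₂ k₃) (piClosedE (k₂ - exI) k₃)) (piClosedE k₂ (k₃ - exI))

/-- ★ the decidable side condition of `ntClosedE_eval`. -/
def ntOk (k₂ k₃ : ℤ × ℤ) : Bool := okPair k₂ k₃ && okPair (k₂ - exI) k₃ && okPair k₂ (k₃ - exI)

section evals
variable (Δ lam2 : ℝ) (f : Tor L → ℝ)

/-- ★ `V²·(piClosedE q₂ q₃).eval = piClosedU(q̄₂,q̄₃)` (`okPair q₂ q₃`, ground profile, `L ≥ 7`). -/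
theorem piClosedE_eval (hL : 7 ≤ L) (hΔ0 : 0 ≤ Δ) (hΔ1 : Δ < 1) (hf : IsGroundTwoMagnon L Δ lam2 f) (hlam : 0 < lam2)
    (e0 : Tor L) {q₂ q₃ : ℤ × ℤ} (hq : okPair q₂ q₃ = true) :
    ((L : ℂ) ^ 2) ^ 2 * (((piClosedE q₂ q₃).eval (xTrueD L Δ lam2 f) : ℝ) : ℂ)
      = piClosedU L Δ lam2 f e0 (B1.toTor L q₂) (B1.toTor L q₃) := by
  have hV : ((L : ℂ) ^ 2) ^ 2 ≠ 0 := by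
    have : (L : ℂ) ≠ 0 := by exact_mod_cast NeZero.ne L
    positivity
  simp only [okPair, Bool.and_eq_true, okPt_iff] at hq
  obtain ⟨⟨⟨h2, h3⟩, h23⟩, hn2⟩ := hq
  have hc := fun (k3 k1 k2 : Bool) =>
    (eq_div_iff hV).mp (closedM_eval L Δ lam2 f hL hΔ0 hΔ1 hf hlam k3 k1 k2 e0 e0 e0 h2 h3 h23 hn2)
  unfold piClosedU
  simp only [monoList8, monoList, List.map_cons, List.map_nil, List.sum_cons, List.sum_nil, add_zero]
  rw [← hc false false false, ← hc true false false, ← hc false false true, ← hc true false true,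
    ← hc false true false, ← hc true true false, ← hc false true true, ← hc true true true]
  simp only [piClosedE, RExpr.eval]
  push_cast
  ring

/-- ★ `V²·(ntClosedE k₂ k₃).eval = ntClosedU(k̄₂,k̄₃)` (`ntOk k₂ k₃`, ground profile, `L ≥ 7`). -/
theorem ntClosedE_eval (hL : 7 ≤ L) (hΔ0 : 0 ≤ Δ) (hΔ1 : Δ < 1) (hf : IsGroundTwoMagnon L Δ lam2 f) (hlam : 0 < lam2)
    (e0 : Tor L) {k₂ k₃ : ℤ × ℤ} (hok : ntOk k₂ k₃ = true) :
    ((L : ℂ) ^ 2) ^ 2 * (((ntClosedE k₂ k₃).eval (xTrueD L Δ lam2 f) : ℝ) : ℂ)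
      = ntClosedU L Δ lam2 f e0 (B1.toTor L k₂) (B1.toTor L k₃) := by
  simp only [ntOk, Bool.and_eq_true] at hok
  obtain ⟨⟨h0, h1⟩, h2⟩ := hok
  have e0' := piClosedE_eval L Δ lam2 f hL hΔ0 hΔ1 hf hlam e0 h0
  have e1 := piClosedE_eval L Δ lam2 f hL hΔ0 hΔ1 hf hlam e0 h1
  have e2 := piClosedE_eval L Δ lam2 f hL hΔ0 hΔ1 hf hlam e0 h2
  have ht2 : B1.toTor L k₂ - K1 L = B1.toTor L (k₂ - exI) := by rw [K1_eq_toTor, ← RowC.toTor_sub]; rfl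
  have ht3 : B1.toTor L k₃ - K1 L = B1.toTor L (k₃ - exI) := by rw [K1_eq_toTor, ← RowC.toTor_sub]; rfl
  unfold ntClosedU
  rw [ht2, ht3, ← e0', ← e1, ← e2]
  simp only [ntClosedE, RExpr.eval]
  push_cast
  ring

end evals

end RowD

end Summit.HubbardSuperconductivity.HubbardSuperconductivity.Theorems.AnisotropyChord.Transfer.Fibre3
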